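import Summits.QuantumFields.YangMills.Theorems.UnitScaleTiltProp7CornerCombL1Engine
import Summits.QuantumFields.YangMills.Theorems.UnitScaleTiltProp7LatticeLocalisedMass
import HarnessLib

/-!
# (n3)-COMB (II), row `hMcomb₂`, located difficulty H2-1 — THE TIED SOURCE ON A READING BOX: TWO-BLOCK LIFT + THE d = 3 LOCALISED-MASS PRICING (norm-gap currency)

Crux `stmt-QuantumFields-19200` `MinimiserStabilityRegPr`, route-R E′ (A′)-on-Σ, P-A2 (β); supplier design (II) (★routeR-w1 g9 MASTER 6efb31c3 §4: H2-1 «the Λ-sector only SAMPLES the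
source near the coarse corners»); ★px17's H-line (H-4b: the sources `s_j` are TIED — `‖s_j(y,κ)‖ ≤ 260·((2d+2)L)²·M₂,j(y,κ)`, two-block masses of `Ỹ_j`; px13 g6's caveat).  Width seat
`ym3-torus-px18` (gen 4); `--kind proof --supports stmt-QuantumFields-19200 --as helper`; THEOREMS ONLY; «(O2) groundwork»; count-neutral.  YM₃ on T³ is a ladder rung (R3), not Clay;
nothing here is progress on the YM mass gap.

## The point
`…CornerCombL1PropagationBoxes.sum_norm_linTower_le_boxes` prices the cornered tower of a source `s` by `ℓ¹` sums of `s` over READING BOXES `box q ρ` below the coarse corners.  For a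
TIED source — `‖s y κ‖ ≤ C·M₂(y,κ)`, `M₂(y,κ) = Σ_{σ,ν}(‖Ỹ(L•y + σ) ν‖² + ‖Ỹ(L•y + L•e_κ + σ) ν‖²)` (✓H-3a ∕ ★routeR-w6's brick letter, `C = 260·((2d+2)L)²`) — the reading-box sum is
(§1) at most `C·2d·Σ_{y ∈ box (L•q) (Lρ+2L)}Σ_ν‖Ỹ y ν‖²` (two-block LIFT: the blocks of the box land in the finer box, each fine site at most once per direction and block type —
✓p710753 `sum_block_offset_le`), and then (§2, `d = 3`) ✓p705643 `sum_sq_le_localisedMass` applied to `v := ‖Ỹ · ν‖` per direction prices it by the VOLUME FRACTION of the `ℓ²` mass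
of `Ỹ` in a big concentric box plus `13068·(ρ₁+1)²`× the NORM-GAP energy `Σ_yΣ_νΣ_μ(‖Ỹ(y+e_μ) ν‖ − ‖Ỹ y ν‖)²` (≤ any covariant gradient energy: `Ad` is isometric — the member's
currency).  The radius of the priced box is `ρ₁ = Lρ + 2L`, INDEPENDENT of the coarse level.
* §1 ★ `sum_norm_tied_le_twoBlock_box` (two-block lift on a box; any `d`, any normed group).
* §2 (`d = 3`) ★★ `sum_sq_norm_box_le_localisedMass_normGap` (✓p705643 per direction, norm-gap form), ★★★ `sum_norm_tied_box_le_localisedMass` (§1 ∘ §2: the priced reading box).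
DEPENDENCE: `C`, `2d`, `(1+t)·#Q_{ρ₁}∕#Q_R`, `(1+t⁻¹)·13068·(ρ₁+1)²` — nothing reads the coarse level.  NOT HERE: cells∕periodicity, the member's covariant gradient currency, windows.
HONEST: bookkeeping over landed rows; nothing of H2-1's member ∕ `hMcomb₂` ∕ `hMcomb` ∕ (β) ∕ the crux is proved or claimed; rung R3 (YM₃ on T³), NOT d = 4, NOT Clay; YM gap NOT proved.
References: T. Bałaban, CMP 98 (1985) 17–51 [Balaban1985Averaging] ((2) p.17, (42) p.23, (124)–(126) p.36); M. Giaquinta, *Multiple integrals…* [Giaquinta1984] (Ch. III §1 pp.64–72).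
-/

set_option autoImplicit false

noncomputable section

open scoped BigOperators
open Finset

namespace Summit.QuantumFields.YangMills.Theorems.Prop7CornerCombTiedSourceBoxes

open Literature.MathematicalPhysics.QuantumFieldTheory.Balaban1983to89
open B7Prop1Explicit (Site e e_apply boxVec)
open B4Eq19LatticeOperators (Zd box mem_box box_mono unitVec gradSq gradSq_def fdiff fdiff_apply)
open Summit.QuantumFields.YangMills.Theorems.Prop7CornerCombL1Engine (sum_block_offset_le)
open Summit.QuantumFields.YangMills.Theorems.Prop7LatticeLocalisedMass (sum_sq_le_localisedMass)

/-! ## §1 The two-block lift on a reading box (any `d`) -/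

section Lift

variable {d : ℕ} {𝔸 : Type*} [SeminormedAddCommGroup 𝔸] {𝔅 : Type*} [SeminormedAddCommGroup 𝔅]

/-- one coordinate of a block point relative to the scaled centre: `|(L•y + v + σ)_i − (L•q)_i| ≤ L·|y_i − q_i| + |v_i| + (L − 1)`. [folklore] -/
theorem abs_coord_block_offset_le (L : ℕ) (y q v : Site d) (σ : Fin d → Fin L) (i : Fin d) :
    |((L : ℤ) • y + v + boxVec L σ) i - ((L : ℤ) • q) i| ≤ (L : ℤ) * |y i - q i| + |v i| + ((L : ℤ) - 1) := by
  have hσ : (0 : ℤ) ≤ ((σ i : ℕ) : ℤ) ∧ ((σ i : ℕ) : ℤ) ≤ (L : ℤ) - 1 := by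
    constructor
    · positivity
    · have := (σ i).isLt; omega
  have hL0 : (0 : ℤ) ≤ L := by positivity
  simp only [Pi.add_apply, Pi.smul_apply, smul_eq_mul, boxVec]
  have key : (L : ℤ) * y i + v i + ((σ i : ℕ) : ℤ) - (L : ℤ) * q i = (L : ℤ) * (y i - q i) + (v i + ((σ i : ℕ) : ℤ)) := by ring
  rw [key]
  calc |(L : ℤ) * (y i - q i) + (v i + ((σ i : ℕ) : ℤ))| ≤ |(L : ℤ) * (y i - q i)| + |v i + ((σ i : ℕ) : ℤ)| := abs_add_le _ _
    _ ≤ (L : ℤ) * |y i - q i| + (|v i| + |((σ i : ℕ) : ℤ)|) := by rw [abs_mul, abs_of_nonneg hL0]; linarith [abs_add_le (v i) (((σ i : ℕ) : ℤ))]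
    _ ≤ (L : ℤ) * |y i - q i| + |v i| + ((L : ℤ) - 1) := by rw [abs_of_nonneg hσ.1]; linarith [hσ.2]

/-- the blocks of a box land in the scaled box: `y ∈ box q ρ`, `|v_i| ≤ L` ⇒ `L•y + v + σ ∈ box (L•q) (L·ρ + 2L)`. [folklore] [cite: Balaban1985Averaging, (2) p.17] -/
theorem block_offset_mem_box (L : ℕ) {y q : Site d} {ρ : ℤ} (hy : y ∈ box q ρ) (v : Site d) (hv : ∀ i, |v i| ≤ (L : ℤ)) (σ : Fin d → Fin L) :
    (L : ℤ) • y + v + boxVec L σ ∈ box ((L : ℤ) • q) ((L : ℤ) * ρ + 2 * L) := by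
  rw [mem_box] at hy ⊢
  intro i
  have h := abs_coord_block_offset_le L y q v σ i
  have hL0 : (0 : ℤ) ≤ L := by positivity
  nlinarith [hy i, hv i, abs_nonneg (y i - q i)]

/-- `|(L•e_μ)_i| ≤ L` and `|0_i| ≤ L`. [folklore] -/
theorem abs_smul_e_apply_le (L : ℕ) (μ i : Fin d) : |((L : ℤ) • e μ) i| ≤ (L : ℤ) := by
  simp only [Pi.smul_apply, smul_eq_mul, e_apply]
  split_ifs <;> simp

/-- ★ **THE TWO-BLOCK LIFT ON A READING BOX**: if `‖s y κ‖ ≤ C·Σ_{σ,ν}(g(L•y + σ) ν + g(L•y + L•e_κ + σ) ν)` pointwise (`C ≥ 0`, `g ≥ 0`; e.g. `g x ν = ‖Ỹ x ν‖²`), then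
`Σ_{y ∈ box q ρ}Σ_κ‖s y κ‖ ≤ C·2d·Σ_{x ∈ box (L•q) (Lρ + 2L)}Σ_ν g x ν` — each fine site is hit at most once per direction and block type (✓p710753 `sum_block_offset_le`).
[cite: Balaban1985Averaging, (2) p.17, (124)–(126) p.36] -/
theorem sum_norm_tied_le_twoBlock_box (L : ℕ) (hL : 1 ≤ L) (s : Site d → Fin d → 𝔸) (g : Site d → Fin d → ℝ) (hg : ∀ x ν, 0 ≤ g x ν)
    {C : ℝ} (hC : 0 ≤ C)
    (hs : ∀ (y : Site d) (κ : Fin d), ‖s y κ‖ ≤ C * ∑ σ : Fin d → Fin L, ∑ ν : Fin d,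
      (g ((L : ℤ) • y + boxVec L σ) ν + g ((L : ℤ) • y + (L : ℤ) • e κ + boxVec L σ) ν))
    (q : Site d) (ρ : ℤ) :
    ∑ y ∈ box q ρ, ∑ κ : Fin d, ‖s y κ‖ ≤ C * (2 * d * ∑ x ∈ box ((L : ℤ) • q) ((L : ℤ) * ρ + 2 * L), ∑ ν : Fin d, g x ν) := by
  set Bf := box ((L : ℤ) • q) ((L : ℤ) * ρ + 2 * L) with hBf
  set Gs : ℝ := ∑ x ∈ Bf, ∑ ν : Fin d, g x ν with hGs
  have hGν : ∀ x ∈ Bf, 0 ≤ ∑ ν : Fin d, g x ν := fun x _ => Finset.sum_nonneg fun ν _ => hg x ν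
  -- block type 1 (`v = 0`) and block type 2 (`v = L•e κ`), for every direction κ
  have h0 : ∑ y ∈ box q ρ, ∑ σ : Fin d → Fin L, ∑ ν : Fin d, g ((L : ℤ) • y + boxVec L σ) ν ≤ Gs := by
    have h := sum_block_offset_le L hL (box q ρ) Bf 0 (fun x => ∑ ν : Fin d, g x ν) hGν
      (fun y hy σ => by exact block_offset_mem_box L hy 0 (fun i => by simp) σ)
    simpa using h
  have h1 : ∀ κ : Fin d, ∑ y ∈ box q ρ, ∑ σ : Fin d → Fin L, ∑ ν : Fin d, g ((L : ℤ) • y + (L : ℤ) • e κ + boxVec L σ) ν ≤ Gs := fun κ =>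
    sum_block_offset_le L hL (box q ρ) Bf ((L : ℤ) • e κ) (fun x => ∑ ν : Fin d, g x ν) hGν
      (fun y hy σ => block_offset_mem_box L hy ((L : ℤ) • e κ) (fun i => abs_smul_e_apply_le L κ i) σ)
  calc ∑ y ∈ box q ρ, ∑ κ : Fin d, ‖s y κ‖
      ≤ ∑ y ∈ box q ρ, ∑ κ : Fin d, C * ∑ σ : Fin d → Fin L, ∑ ν : Fin d,
          (g ((L : ℤ) • y + boxVec L σ) ν + g ((L : ℤ) • y + (L : ℤ) • e κ + boxVec L σ) ν) :=
        Finset.sum_le_sum fun y _ => Finset.sum_le_sum fun κ _ => hs y κ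
    _ = C * ∑ κ : Fin d, (∑ y ∈ box q ρ, ∑ σ : Fin d → Fin L, ∑ ν : Fin d, g ((L : ℤ) • y + boxVec L σ) ν +
          ∑ y ∈ box q ρ, ∑ σ : Fin d → Fin L, ∑ ν : Fin d, g ((L : ℤ) • y + (L : ℤ) • e κ + boxVec L σ) ν) := by
        rw [Finset.sum_comm, Finset.mul_sum]
        refine Finset.sum_congr rfl fun κ _ => ?_
        rw [← Finset.mul_sum, ← Finset.sum_add_distrib]
        congr 1
        refine Finset.sum_congr rfl fun y _ => ?_
        rw [← Finset.sum_add_distrib]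
        refine Finset.sum_congr rfl fun σ _ => ?_
        rw [← Finset.sum_add_distrib]
    _ ≤ C * ∑ _κ : Fin d, (Gs + Gs) := by
        refine mul_le_mul_of_nonneg_left (Finset.sum_le_sum fun κ _ => add_le_add h0 (h1 κ)) hC
    _ = C * (2 * d * ∑ x ∈ Bf, ∑ ν : Fin d, g x ν) := by
        rw [Finset.sum_const, Finset.card_univ, Fintype.card_fin, nsmul_eq_mul, hGs]; ring

end Lift

/-! ## §2 The priced reading box (`d = 3`, norm-gap currency) -/

section Priced

variable {d : ℕ} {𝔅 : Type*} [SeminormedAddCommGroup 𝔅]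

/-- `(‖a‖ − ‖b‖)² ≤ ‖a − b‖²` (reverse triangle inequality, squared). [folklore] -/
theorem sq_norm_sub_norm_le' (a b : 𝔅) : (‖a‖ - ‖b‖) ^ 2 ≤ ‖a - b‖ ^ 2 := by
  have h := abs_norm_sub_norm_le a b
  have h0 : 0 ≤ |‖a‖ - ‖b‖| := abs_nonneg _
  calc (‖a‖ - ‖b‖) ^ 2 = |‖a‖ - ‖b‖| ^ 2 := (sq_abs _).symm
    _ ≤ ‖a - b‖ ^ 2 := pow_le_pow_left₀ h0 h 2

/-- ★★ **THE LOCALISED-MASS ROW FOR A NORMED-GROUP-VALUED FIELD, NORM-GAP CURRENCY** (`d = 3`; ✓p705643 `sum_sq_le_localisedMass` at `v := ‖Ỹ · ν‖` per direction ν, summed):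
`Σ_{x∈box a ρ}Σ_ν‖Ỹ x ν‖² ≤ (1+t)·(#Q_ρ∕#Q_R)·Σ_{x∈box a R}Σ_ν‖Ỹ x ν‖² + (1+t⁻¹)·13068·(ρ+1)²·Σ_{x∈box a R}Σ_νΣ_μ(‖Ỹ(x + e_μ) ν‖ − ‖Ỹ x ν‖)²` — no inner product needed; the norm gap is
bounded by ANY covariant difference (the member's currency). [folklore] [cite: Giaquinta1984, Ch. III §1 pp.65–72; Balaban1984PropagatorsII, (1.9) p.226] -/
theorem sum_sq_norm_box_le_localisedMass_normGap (hd : d = 3) (Yt : Site d → Fin d → 𝔅) (a : Site d) {ρ R : ℤ} (hρ : 0 ≤ ρ) (hρR : ρ ≤ R)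
    {t : ℝ} (ht : 0 < t) :
    ∑ x ∈ box a ρ, ∑ ν : Fin d, ‖Yt x ν‖ ^ 2 ≤
      (1 + t) * (((box a ρ).card : ℝ) / ((box a R).card : ℝ)) * ∑ x ∈ box a R, ∑ ν : Fin d, ‖Yt x ν‖ ^ 2 +
        (1 + 1 / t) * 13068 * ((ρ : ℝ) + 1) ^ 2 * ∑ x ∈ box a R, ∑ ν : Fin d, ∑ μ : Fin d, (‖Yt (x + e μ) ν‖ - ‖Yt x ν‖) ^ 2 := by
  have hν : ∀ ν : Fin d, ∑ x ∈ box a ρ, ‖Yt x ν‖ ^ 2 ≤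
      (1 + t) * (((box a ρ).card : ℝ) / ((box a R).card : ℝ)) * ∑ x ∈ box a R, ‖Yt x ν‖ ^ 2 +
        (1 + 1 / t) * 13068 * ((ρ : ℝ) + 1) ^ 2 * ∑ x ∈ box a R, ∑ μ : Fin d, (‖Yt (x + e μ) ν‖ - ‖Yt x ν‖) ^ 2 := by
    intro ν
    have h := sum_sq_le_localisedMass hd (fun x => ‖Yt x ν‖) a hρ hρR ht
    rw [gradSq_def] at h
    simp only [fdiff_apply] at h
    exact h
  calc ∑ x ∈ box a ρ, ∑ ν : Fin d, ‖Yt x ν‖ ^ 2 = ∑ ν : Fin d, ∑ x ∈ box a ρ, ‖Yt x ν‖ ^ 2 := Finset.sum_comm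
    _ ≤ ∑ ν : Fin d, ((1 + t) * (((box a ρ).card : ℝ) / ((box a R).card : ℝ)) * ∑ x ∈ box a R, ‖Yt x ν‖ ^ 2 +
        (1 + 1 / t) * 13068 * ((ρ : ℝ) + 1) ^ 2 * ∑ x ∈ box a R, ∑ μ : Fin d, (‖Yt (x + e μ) ν‖ - ‖Yt x ν‖) ^ 2) :=
        Finset.sum_le_sum fun ν _ => hν ν
    _ = _ := by
        rw [Finset.sum_add_distrib, ← Finset.mul_sum, ← Finset.mul_sum, Finset.sum_comm]
        congr 1
        rw [Finset.sum_comm]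

variable {𝔸 : Type*} [SeminormedAddCommGroup 𝔸]

/-- ★★★ **THE PRICED READING BOX OF A TIED SOURCE** (`d = 3`, §1 ∘ §2): with `ρ₁ := Lρ + 2L ≤ R`, a tied source `‖s y κ‖ ≤ C·M₂(y,κ)` (two-block `ℓ²` masses of `Ỹ`) satisfies
`Σ_{y∈box q ρ}Σ_κ‖s y κ‖ ≤ C·2d·[(1+t)·(#Q_{ρ₁}∕#Q_R)·Σ_{x∈box (L•q) R}Σ_ν‖Ỹ x ν‖² + (1+t⁻¹)·13068·(ρ₁+1)²·Σ_{x∈box (L•q) R}Σ_νΣ_μ(‖Ỹ(x+e_μ) ν‖ − ‖Ỹ x ν‖)²]` — the reading box of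
the Λ-sector priced by the VOLUME FRACTION of the big concentric box plus the SMALL radius squared times the norm-gap energy (MASTER §4's device, by kernel).
«(O2) groundwork.» [cite: Balaban1985Averaging, (2) p.17, (124)–(126) p.36; Giaquinta1984, Ch. III §1 pp.65–72] -/
theorem sum_norm_tied_box_le_localisedMass (hd : d = 3) (L : ℕ) (hL : 1 ≤ L) (s : Site d → Fin d → 𝔸) (Yt : Site d → Fin d → 𝔅)
    {C : ℝ} (hC : 0 ≤ C)
    (hs : ∀ (y : Site d) (κ : Fin d), ‖s y κ‖ ≤ C * ∑ σ : Fin d → Fin L, ∑ ν : Fin d,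
      (‖Yt ((L : ℤ) • y + boxVec L σ) ν‖ ^ 2 + ‖Yt ((L : ℤ) • y + (L : ℤ) • e κ + boxVec L σ) ν‖ ^ 2))
    (q : Site d) {ρ R : ℤ} (hρ : 0 ≤ ρ) (hR : (L : ℤ) * ρ + 2 * L ≤ R) {t : ℝ} (ht : 0 < t) :
    ∑ y ∈ box q ρ, ∑ κ : Fin d, ‖s y κ‖ ≤
      C * (2 * d * ((1 + t) * (((box ((L : ℤ) • q) ((L : ℤ) * ρ + 2 * L)).card : ℝ) / ((box ((L : ℤ) • q) R).card : ℝ)) *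
            ∑ x ∈ box ((L : ℤ) • q) R, ∑ ν : Fin d, ‖Yt x ν‖ ^ 2 +
          (1 + 1 / t) * 13068 * ((((L : ℤ) * ρ + 2 * L : ℤ) : ℝ) + 1) ^ 2 *
            ∑ x ∈ box ((L : ℤ) • q) R, ∑ ν : Fin d, ∑ μ : Fin d, (‖Yt (x + e μ) ν‖ - ‖Yt x ν‖) ^ 2)) := by
  have h1 := sum_norm_tied_le_twoBlock_box L hL s (fun x ν => ‖Yt x ν‖ ^ 2) (fun _ _ => sq_nonneg _) hC hs q ρ
  have hρ1 : (0 : ℤ) ≤ (L : ℤ) * ρ + 2 * L := by positivity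
  have h2 := sum_sq_norm_box_le_localisedMass_normGap hd Yt ((L : ℤ) • q) hρ1 hR ht
  have hd0 : (0 : ℝ) ≤ 2 * d := by positivity
  exact h1.trans (mul_le_mul_of_nonneg_left (mul_le_mul_of_nonneg_left h2 hd0) hC)

end Priced

end Summit.QuantumFields.YangMills.Theorems.Prop7CornerCombTiedSourceBoxes

end
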